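import Literature.Barriers.BirchSwinnertonDyer.RankNotSumOfLocalInvariantsCubicRanks
import Literature.Barriers.BirchSwinnertonDyer.RankNotSumOfLocalInvariantsF5HoldsProofs
import HarnessLib

/-!
# Barrier (BirchSwinnertonDyer): the rank modulo `n ∈ {3, 4, 5}` is not a sum of local invariants — the named facts hold

The entry barrier `Literature.Barriers.BirchSwinnertonDyer.DokchitserDokchitser2011_rankMod_notSumOfLocalInvariants`
(`RankNotSumOfLocalInvariants.lean`; T. Dokchitser–V. Dokchitser, *A note on the Mordell–Weil rank
modulo `n`*, J. Number Theory 131 (2011) 1833–1839, Thm. 2: "For `n ∈ {3,4,5}` the Mordell–Weil rank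
modulo `n` is not a sum of local invariants") and its narrowed record
`DokchitserDokchitser2011_rankMod_notSumOfLocalInvariantsNarrow` (same file) are now THEOREMS of the
tree (`…_holds`). Nothing new is proved here; the file only assembles what the tree already has:

* `n = 3`: `CubicTwist.not_isSumOfLocalInvariants_rankMod_three`
  (`RankNotSumOfLocalInvariantsCubicRanks.lean`, the nine cubic-twist ranks of `y² = x³ + t²` over `ℚ`);
* `n = 4` and the fixed-`ℚ` conjunct of the narrowed record: `not_isSumOfLocalInvariants_rankMod_four`,
  `DokchitserDokchitser2011_rankMod_notSumOfLocalInvariantsNarrow_of_three_five`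
  (`RankNotSumOfLocalInvariantsCNProofs.lean`, the eight quadratic-twist ranks of `480a1` over `ℚ`);
* `n = 5`: the printed witness — `F₅ ⊂ ℚ(ζ₂₆₅₁)` Galois of degree `25`, every rational place with a
  multiple of `5` places above it, `rk 480a1(F₅) = 1` — i.e. the named fact
  `DokchitserDokchitser2011_rank_480a1_F5`, PROVED as `DokchitserDokchitser2011_rank_480a1_F5_holds`
  (`RankNotSumOfLocalInvariantsF5HoldsProofs.lean`: explicit `2`-descents over the six quintic subfields
  of `F₅`), fed to the tree's reductions `CubicTwist.DokchitserDokchitser2011_rankMod_notSumOfLocalInvariants_of_F5`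
  / `…Narrow_of_F5` (Lemma 3, `not_isSumOfLocalInvariants_rankInvariant_of_witness`).

Also recorded: the stand-alone case `n = 5` (`not_isSumOfLocalInvariants_rankMod_five`), next to the
tree's `…_three` and `…_four`. No named fact is introduced.

## References

* T. Dokchitser, V. Dokchitser, *A note on the Mordell–Weil rank modulo `n`*, J. Number Theory 131
  (2011) 1833–1839, arXiv:0910.4588: Thm. 2 and its proof (p. 3: "2-descent shows that
  `rk E/F₃ = rk E/F₅ = 1` and `rk E/F₄ = 6`"), Lemma 3, Lemma 5. [DokchitserDokchitser2011RankModN]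
-/

noncomputable section

namespace Literature.Barriers.BirchSwinnertonDyer

/-- **Theorem 2 of Dokchitser–Dokchitser (2011) holds**: for each `n ∈ {3, 4, 5}` the Mordell–Weil
rank modulo `n` is not a sum of local invariants — the named fact
`DokchitserDokchitser2011_rankMod_notSumOfLocalInvariants`, from the proved `n = 5` witness
`DokchitserDokchitser2011_rank_480a1_F5_holds` (the cases `n = 3, 4` being theorems of
`RankNotSumOfLocalInvariantsCubicRanks.lean` / `RankNotSumOfLocalInvariantsCNProofs.lean`).
[cite: DokchitserDokchitser2011RankModN, Thm. 2] -/
theorem DokchitserDokchitser2011_rankMod_notSumOfLocalInvariants_holds :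
    DokchitserDokchitser2011_rankMod_notSumOfLocalInvariants :=
  CubicTwist.DokchitserDokchitser2011_rankMod_notSumOfLocalInvariants_of_F5
    DokchitserDokchitser2011_rank_480a1_F5_holds

/-- **The narrowed record holds**: Theorem 2 for `n ∈ {3, 4, 5}` (K-uniformly) together with its
fixed-`ℚ` face modulo `4` (no `ℤ/4ℤ`-valued local formula for `rk E(ℚ)` over the places of `ℚ`;
Lemma 5 and the quadratic-twist ranks of `480a1`) — the named fact
`DokchitserDokchitser2011_rankMod_notSumOfLocalInvariantsNarrow`.
[cite: DokchitserDokchitser2011RankModN, Thm. 2 and Lemma 5] -/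
theorem DokchitserDokchitser2011_rankMod_notSumOfLocalInvariantsNarrow_holds :
    DokchitserDokchitser2011_rankMod_notSumOfLocalInvariantsNarrow :=
  CubicTwist.DokchitserDokchitser2011_rankMod_notSumOfLocalInvariantsNarrow_of_F5
    DokchitserDokchitser2011_rank_480a1_F5_holds

/-- **The case `n = 5` of Theorem 2, unconditionally**: the Mordell–Weil rank modulo `5` is not a sum
of local invariants (witness `E = 480a1` over `F₅`, `rk E(F₅) = 1 ≢ 0 (mod 5)`, Lemma 3).
[cite: DokchitserDokchitser2011RankModN, Thm. 2 (proof)] -/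
theorem not_isSumOfLocalInvariants_rankMod_five :
    ¬ IsSumOfLocalInvariants (rankInvariant (ZMod 5)) :=
  DokchitserDokchitser2011_rankMod_notSumOfLocalInvariants_holds 5 (by decide)

end Literature.Barriers.BirchSwinnertonDyer

end
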